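import Summits.MatrixMultiplication.MatrixMultiplication.Theorems.EdgePencilTriangles
import Summits.MatrixMultiplication.MatrixMultiplication.Theorems.TetraDiagonalSymm
import HarnessLib

/-!
# The sixth-edge ladder, finite level: the tetrahedron with one thinned edge `W_n^{(e)}` and its
# block decomposition `R₄(W_n^{(B·e)}) ≤ B · R₄(W_n^{(e)})`

Support kernel for `stmt-MatrixMultiplication-33477` (`TetraFlat`) of route `TetrahedronCarving`
(lineage `decomp-mm-lens-6`, generation 20). Companion of `EdgePencilExcess`: there the attacked
leaf splits as `TetraFlat ⟺ (α ≥ 1/2) ∧ ExcessZero` with `ExcessZero : ω(K₄) ≤ ω(2,1,2) = ψ(1)`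
(«the sixth edge is free»). This file builds the finite-level instrument for `ExcessZero`: the
one-parameter family
  `W_n^{(e)} := χ[ℓ₀₁ < e] · T(K₄)_n`  (edge `01` of bond `e`, the other five edges of bond `n`),
interpolating between the diamond `W_n^{(1)} = D_n = P_n^{(n)}` (`sixTetra_one`) and the tetrahedron
`W_n^{(n)} = T(K₄)_n` (`sixTetra_of_le`).

* §1 the object, restriction (`R₄(W^{(e)}) ≤ R₄(T(K₄)_n)`), monotonicity in `e`, `R₄(D_n) ≤ R₄(W^{(e)})`.
* §2 relabelling the sixth edge: a permutation `σ` of the `01`-labels, applied at both endpoints,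
  fixes `T(K₄)_n` (`tetra_relab₀₁`, an instance of the tree's `tetra_relabel`).
* §3 **block decomposition** (`tensorRankD_sixTetra_mul_le`): cutting the label range `[0, B·e)` of
  the thinned edge into `B` blocks of length `e` writes `W^{(B·e)}` as a sum of `B` tensors, each a
  leg-restriction of a relabelled copy of `W^{(e)}`; hence `R₄(W_n^{(B·e)}) ≤ B · R₄(W_n^{(e)})`
  (an EPR pair of bond `B·e` is `B` block-diagonal EPR pairs of bond `e`).
* §4 corollaries: `R₄(W_n^{(e')}) ≤ (⌊e'/e⌋ + 1) · R₄(W_n^{(e)})`, the diamond cover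
  `R₄(W_n^{(e)}) ≤ e · R₄(D_n)` and the top continuity `R₄(T(K₄)_n) ≤ (⌊n/e⌋ + 1) · R₄(W_n^{(e)})`.
  In exponents (`EdgePencilSixthLadder`): `ω(2,1,2) ≤ χ(δ) ≤ ω(2,1,2) + δ` and `ω(K₄) ≤ χ(δ) + 1 − δ`.

References: Christandl–Vrana–Zuiddam, arXiv:1609.07476, Ex. 1.1.2, §1.1 (graph tensors with
non-uniform bond dimensions, restriction). [ChristandlVranaZuiddam2016]
-/

noncomputable section

set_option linter.dupNamespace false

open Finset Literature.Computability.AlgebraicComplexity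
open Summit.MatrixMultiplication.MatrixMultiplication.Theorems.TetrahedronTensor
open Summit.MatrixMultiplication.MatrixMultiplication.Theorems.TetraDiagonal

namespace Summit.MatrixMultiplication.MatrixMultiplication.Theorems.EdgePencil

/-! ## §1 The tetrahedron with a thinned sixth edge -/

section Object

variable (F : Type*) [Field F]

/-- The legs of `W_n^{(e)}`: vertex `0` tests its slot `0` (the label of edge `01`) for `< e`. -/
def sixLegs (n e : ℕ) : Fin 4 → Fin (n ^ 3) → F :=
  ![thinInd F n e 0, fun _ => 1, fun _ => 1, fun _ => 1]

/-- **`W_n^{(e)}`**: the graph tensor of `K₄` with bond `e` on the edge `01` and bond `n` on the other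
five edges, inside the format of `T(K₄)_n`. (CVZ19 Ex. 1.1.2, non-uniform bond dimensions). -/
def sixTetra (n e : ℕ) : (Fin 4 → Fin (n ^ 3)) → F :=
  fun i => thinInd F n e 0 (i 0) * tetra F n i

variable {F}

/-- The leg product of `sixLegs`. -/
theorem prod_sixLegs {n e : ℕ} (i : Fin 4 → Fin (n ^ 3)) :
    ∏ v, sixLegs F n e v (i v) = thinInd F n e 0 (i 0) := by
  rw [Fin.prod_univ_four]
  simp [sixLegs]

/-- `W^{(e)}` is a leg-restriction of `T(K₄)_n`. -/
theorem sixTetra_eq_legMul_tetra (n e : ℕ) :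
    sixTetra F n e = fun i => (∏ v, sixLegs F n e v (i v)) * tetra F n i := by
  funext i
  rw [prod_sixLegs, sixTetra]

/-- **`R₄(W_n^{(e)}) ≤ R₄(T(K₄)_n)`** (restriction). [folklore] -/
theorem tensorRankD_sixTetra_le_tetra (n e : ℕ) :
    tensorRankD (sixTetra F n e) ≤ tensorRankD (tetra F n) := by
  rw [sixTetra_eq_legMul_tetra (F := F) n e]
  exact tensorRankD_legMul_le _ _ (tetra_decomposable n)

/-- `W_n^{(e)}` decomposes over rank-one tensors. -/
theorem sixTetra_decomposable (n e : ℕ) :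
    ∃ s : ℕ, ∃ g : Fin s → ((Fin 4 → Fin (n ^ 3)) → F),
      (∀ k, g k ∈ rankOneTensors F (n ^ 3) 4) ∧ ∑ k, g k = sixTetra F n e := by
  rw [sixTetra_eq_legMul_tetra (F := F) n e]
  exact legMul_decomposable (tetra F n) (sixLegs F n e) (tetra_decomposable n)

/-- A rank-one decomposition of `W_n^{(e)}` of length exactly `R₄(W_n^{(e)})`. [folklore] -/
theorem exists_rankOne_decomposition_sixTetra (n e : ℕ) :
    ∃ u : Fin (tensorRankD (sixTetra F n e)) → Fin 4 → Fin (n ^ 3) → F,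
      ∑ k, rankOneTensor (u k) = sixTetra F n e := by
  classical
  obtain ⟨g, hg, hs⟩ := sComplexity_spec (sixTetra_decomposable (F := F) n e)
  simp only [rankOneTensors, Set.mem_range] at hg
  choose u hu using hg
  have h : ∑ k, rankOneTensor (u k) = ∑ k, g k := Finset.sum_congr rfl fun k _ => hu k
  exact ⟨u, h.trans hs⟩

/-- **`W_n^{(1)} = D_n`**: bond `1` on the sixth edge is the diamond `P_n^{(n)} = T(K₄ - e)_n`. -/
theorem sixTetra_one (n : ℕ) : sixTetra F n 1 = pencil F n n := by
  funext i
  simp only [sixTetra, pencil, prod_pencilLegs]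
  rw [thinInd_eq_one (d := n) (j := 2) (Fin.is_lt _), mul_one]

/-- **Saturation `W_n^{(e)} = T(K₄)_n` for `e ≥ n`.** -/
theorem sixTetra_of_le {n e : ℕ} (h : n ≤ e) : sixTetra F n e = tetra F n := by
  funext i
  rw [sixTetra, thinInd_eq_one (lt_of_lt_of_le (Fin.is_lt _) h), one_mul]

/-- Nested thinning: `W^{(e)} = χ_e · W^{(e')}` for `e ≤ e'`. -/
theorem sixTetra_eq_legMul_sixTetra {n e e' : ℕ} (h : e ≤ e') :
    sixTetra F n e = fun i => (∏ v, sixLegs F n e v (i v)) * sixTetra F n e' i := by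
  funext i
  rw [prod_sixLegs, sixTetra, sixTetra, ← mul_assoc, thinInd_mul_thinInd_of_le h]

/-- **Monotone in the bond of the thinned edge.** [folklore] -/
theorem tensorRankD_sixTetra_mono {n e e' : ℕ} (h : e ≤ e') :
    tensorRankD (sixTetra F n e) ≤ tensorRankD (sixTetra F n e') := by
  rw [sixTetra_eq_legMul_sixTetra (F := F) (n := n) h]
  exact tensorRankD_legMul_le _ _ (sixTetra_decomposable n e')

/-- **`R₄(D_n) ≤ R₄(W_n^{(e)})`** for `e ≥ 1` (the diamond sits in every member). [folklore] -/
theorem tensorRankD_pencil_le_sixTetra {n e : ℕ} (he : 1 ≤ e) :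
    tensorRankD (pencil F n n) ≤ tensorRankD (sixTetra F n e) := by
  rw [← sixTetra_one]
  exact tensorRankD_sixTetra_mono he

/-- Degenerate format: at `n = 0` every tensor in the format of `T(K₄)_0` has rank `0`. -/
theorem tensorRankD_eq_zero_of_level_zero (T : (Fin 4 → Fin (0 ^ 3)) → F) : tensorRankD T = 0 := by
  have hT : ∑ k : Fin 0, rankOneTensor (Fin.elim0 k : Fin 4 → Fin (0 ^ 3) → F) = T := by
    rw [Finset.univ_eq_empty, Finset.sum_empty]
    funext i
    exact absurd (i 0).isLt (by simp)
  exact Nat.le_zero.1 (tensorRankD_le_of_eq_sum _ hT)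

end Object

/-! ## §2 Relabelling the sixth edge -/

section Relabel

variable {F : Type*} [Field F]

/-- Per-edge relabellings: `σ` on edge `01` (edge index `0`), identity on the other five edges. -/
def edgeRelab {n : ℕ} (σ : Equiv.Perm (Fin n)) : Fin 6 → Fin n → Fin n :=
  Function.update (fun _ : Fin 6 => (id : Fin n → Fin n)) 0 σ

/-- The induced leg maps: at vertex `v`, slot `j` (belonging to edge `vertexLabels id v j`) is
relabelled by `edgeRelab σ` of that edge — i.e. slot `0` of vertices `0` and `1` by `σ`. -/
def relab₀₁ {n : ℕ} (σ : Equiv.Perm (Fin n)) (v : Fin 4) (x : Fin (n ^ 3)) : Fin (n ^ 3) :=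
  finFunctionFinEquiv fun j =>
    edgeRelab σ (vertexLabels (fun k : Fin 6 => k) v j) (finFunctionFinEquiv.symm x j)

/-- Each `edgeRelab σ k` is injective. -/
theorem edgeRelab_injective {n : ℕ} (σ : Equiv.Perm (Fin n)) (k : Fin 6) :
    Function.Injective (edgeRelab σ k) := by
  by_cases hk : k = 0
  · subst hk
    simp only [edgeRelab, Function.update_self]
    exact σ.injective
  · simp only [edgeRelab, Function.update_of_ne hk]
    exact Function.injective_id

/-- **`T(K₄)_n` is invariant under relabelling the sixth edge.** [folklore] -/
theorem tetra_relab₀₁ {n : ℕ} (σ : Equiv.Perm (Fin n)) (i : Fin 4 → Fin (n ^ 3)) :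
    tetra F n (fun v => relab₀₁ σ v (i v)) = tetra F n i :=
  tetra_relabel (edgeRelab σ) (edgeRelab_injective σ) i

/-- The relabelled slot `0` of vertex `0` carries `σ` of the old label. -/
theorem symm_relab₀₁_zero_zero {n : ℕ} (σ : Equiv.Perm (Fin n)) (x : Fin (n ^ 3)) :
    finFunctionFinEquiv.symm (relab₀₁ σ 0 x) 0 = σ (finFunctionFinEquiv.symm x 0) := by
  simp [relab₀₁, edgeRelab, vertexLabels]

/-- **`W^{(e)}` after relabelling**: `W_n^{(e)}(σ·i) = [σ(ℓ₀₁(i)) < e] · T(K₄)_n(i)`. -/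
theorem sixTetra_relab₀₁_apply {n e : ℕ} (σ : Equiv.Perm (Fin n)) (i : Fin 4 → Fin (n ^ 3)) :
    sixTetra F n e (fun v => relab₀₁ σ v (i v)) =
      (if ((σ (finFunctionFinEquiv.symm (i 0) 0) : Fin n) : ℕ) < e then (1 : F) else 0) *
        tetra F n i := by
  simp only [sixTetra, thinInd, symm_relab₀₁_zero_zero, tetra_relab₀₁]

end Relabel

/-! ## §3 The block decomposition -/

section Blocks

variable (F : Type*) [Field F]

/-- Indicator of the `b`-th block of length `e` of the `01`-label: `[ℓ₀₁ / e = b]`. -/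
def blockInd (n e b : ℕ) (x : Fin (n ^ 3)) : F :=
  if ((finFunctionFinEquiv.symm x 0 : Fin n) : ℕ) / e = b then 1 else 0

/-- The legs restricting vertex `0` to the `b`-th block. -/
def blockLegs (n e b : ℕ) : Fin 4 → Fin (n ^ 3) → F :=
  ![blockInd F n e b, fun _ => 1, fun _ => 1, fun _ => 1]

/-- The shift permutation `ℓ ↦ ℓ − t` of `Fin n` (subtraction in `ℤ/n`). -/
def shift (n t : ℕ) [NeZero n] : Equiv.Perm (Fin n) :=
  Equiv.subRight (Fin.ofNat n t)

variable {F}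

/-- The leg product of `blockLegs`. -/
theorem prod_blockLegs {n e b : ℕ} (i : Fin 4 → Fin (n ^ 3)) :
    ∏ v, blockLegs F n e b v (i v) = blockInd F n e b (i 0) := by
  rw [Fin.prod_univ_four]
  simp [blockLegs]

/-- **The blocks partition the thinned range**: `∑_{b<B} [ℓ/e = b] = [ℓ < B·e]` (`e ≥ 1`). -/
theorem sum_blockInd_range {n e : ℕ} (he : 0 < e) (B : ℕ) (x : Fin (n ^ 3)) :
    ∑ b ∈ Finset.range B, blockInd F n e b x = thinInd F n (B * e) 0 x := by
  simp only [blockInd, thinInd, Finset.sum_ite_eq, Finset.mem_range, Nat.div_lt_iff_lt_mul he]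

/-- On labels `≥ t` the shift subtracts `t` numerically. -/
theorem val_shift {n t : ℕ} [NeZero n] {v : Fin n} (hv : t ≤ (v : ℕ)) :
    ((shift n t v : Fin n) : ℕ) = v - t := by
  have ht : t < n := lt_of_le_of_lt hv v.isLt
  have hc : ((Fin.ofNat n t : Fin n) : ℕ) = t := by
    rw [Fin.val_ofNat, Nat.mod_eq_of_lt ht]
  rw [shift, Equiv.subRight_apply, Fin.coe_sub_iff_le.2 (by rw [Fin.le_def, hc]; exact hv), hc]

/-- Inside the `b`-th block the shift by `b·e` lands in `[0, e)`:
`[ℓ/e = b] · [shift(ℓ) < e] = [ℓ/e = b]`. -/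
theorem blockInd_mul_shiftInd {n e : ℕ} [NeZero n] (he : 0 < e) (b : ℕ) (x : Fin (n ^ 3)) :
    blockInd F n e b x *
        (if ((shift n (b * e) (finFunctionFinEquiv.symm x 0) : Fin n) : ℕ) < e then (1 : F) else 0) =
      blockInd F n e b x := by
  unfold blockInd
  by_cases h : ((finFunctionFinEquiv.symm x 0 : Fin n) : ℕ) / e = b
  · rw [if_pos h]
    have hlo : b * e ≤ ((finFunctionFinEquiv.symm x 0 : Fin n) : ℕ) := by
      rw [← h]; exact Nat.div_mul_le_self _ _
    have hhi : ((finFunctionFinEquiv.symm x 0 : Fin n) : ℕ) < b * e + e := by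
      rw [← h]; exact Nat.lt_div_mul_add he
    rw [val_shift hlo, if_pos (by omega), one_mul]
  · rw [if_neg h, zero_mul]

/-- The legs of the block terms: from a rank-one decomposition `u` of `W_n^{(e)}`, the `k`-th term
relabelled by the shift of block `b` and restricted to block `b` at vertex `0`. -/
def blockTerm {n e r : ℕ} [NeZero n] (u : Fin r → Fin 4 → Fin (n ^ 3) → F) (b : ℕ) (k : Fin r) :
    Fin 4 → Fin (n ^ 3) → F :=
  fun v x => blockLegs F n e b v x * u k v (relab₀₁ (shift n (b * e)) v x)

/-- **The block decomposition, pointwise**: if `∑_k u_k = W_n^{(e)}` then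
`∑_{b<B} ∑_k blockTerm u b k = W_n^{(B·e)}`. -/
theorem sum_blockTerm {n e r : ℕ} [NeZero n] (he : 0 < e)
    {u : Fin r → Fin 4 → Fin (n ^ 3) → F} (hu : ∑ k, rankOneTensor (u k) = sixTetra F n e)
    (B : ℕ) :
    ∑ b : Fin B, ∑ k, rankOneTensor (blockTerm (e := e) u (b : ℕ) k) = sixTetra F n (B * e) := by
  funext i
  rw [Finset.sum_apply]
  have hb : ∀ b : ℕ, (∑ k, rankOneTensor (blockTerm (e := e) u b k)) i =
      blockInd F n e b (i 0) * tetra F n i := by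
    intro b
    rw [Finset.sum_apply]
    have hk : ∀ k, rankOneTensor (blockTerm (e := e) u b k) i =
        blockInd F n e b (i 0) *
          rankOneTensor (u k) (fun v => relab₀₁ (shift n (b * e)) v (i v)) := by
      intro k
      rw [rankOneTensor_apply, rankOneTensor_apply, ← prod_blockLegs (F := F) (e := e) (b := b) i,
        ← Finset.prod_mul_distrib]
      rfl
    simp only [hk, ← Finset.mul_sum]
    have hpt := congrFun hu (fun v => relab₀₁ (shift n (b * e)) v (i v))
    rw [Finset.sum_apply] at hpt
    rw [hpt, sixTetra_relab₀₁_apply, ← mul_assoc, blockInd_mul_shiftInd he]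
  simp only [hb, ← Finset.sum_mul]
  rw [sixTetra, Fin.sum_univ_eq_sum_range (fun b => blockInd F n e b (i 0)) B,
    sum_blockInd_range he]

/-- **BLOCK BOUND** `R₄(W_n^{(B·e)}) ≤ B · R₄(W_n^{(e)})` (`e ≥ 1`): an EPR pair of bond `B·e` on the
sixth edge is a sum of `B` relabelled EPR pairs of bond `e`. [folklore] -/
theorem tensorRankD_sixTetra_mul_le {n e : ℕ} (he : 0 < e) (B : ℕ) :
    tensorRankD (sixTetra F n (B * e)) ≤ B * tensorRankD (sixTetra F n e) := by
  rcases Nat.eq_zero_or_pos n with hn | hn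
  · subst hn
    rw [tensorRankD_eq_zero_of_level_zero]
    exact Nat.zero_le _
  · haveI : NeZero n := ⟨hn.ne'⟩
    obtain ⟨u, hu⟩ := exists_rankOne_decomposition_sixTetra (F := F) n e
    let U : Fin (B * tensorRankD (sixTetra F n e)) → Fin 4 → Fin (n ^ 3) → F := fun m =>
      blockTerm (e := e) u ((finProdFinEquiv.symm m).1 : ℕ) (finProdFinEquiv.symm m).2
    refine tensorRankD_le_of_eq_sum U ?_
    have h1 : ∑ m, rankOneTensor (U m) =
        ∑ p : Fin B × Fin (tensorRankD (sixTetra F n e)),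
          (fun (b : Fin B) (k : Fin (tensorRankD (sixTetra F n e))) =>
            rankOneTensor (blockTerm (e := e) u (b : ℕ) k)) p.1 p.2 :=
      Fintype.sum_equiv finProdFinEquiv.symm _ _ (fun _ => rfl)
    rw [h1, Fintype.sum_prod_type]
    exact sum_blockTerm he hu B

end Blocks

/-! ## §4 Corollaries: covers along the sixth edge -/

section Corollaries

variable {F : Type*} [Field F]

/-- **`R₄(W_n^{(e')}) ≤ (⌊e'/e⌋ + 1) · R₄(W_n^{(e)})`** (`e ≥ 1`). [folklore] -/
theorem tensorRankD_sixTetra_le_ceilDiv {n e : ℕ} (he : 0 < e) (e' : ℕ) :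
    tensorRankD (sixTetra F n e') ≤ (e' / e + 1) * tensorRankD (sixTetra F n e) := by
  have hle : e' ≤ (e' / e + 1) * e := by
    rw [add_mul, one_mul]
    exact (Nat.lt_div_mul_add he).le
  exact (tensorRankD_sixTetra_mono hle).trans (tensorRankD_sixTetra_mul_le he _)

/-- **The diamond cover of `W^{(e)}`**: `R₄(W_n^{(e)}) ≤ e · R₄(D_n)`. [folklore] -/
theorem tensorRankD_sixTetra_le_mul_diamond (n e : ℕ) :
    tensorRankD (sixTetra F n e) ≤ e * tensorRankD (pencil F n n) := by
  have h := tensorRankD_sixTetra_mul_le (F := F) (n := n) Nat.one_pos e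
  rwa [mul_one, sixTetra_one] at h

/-- **Top continuity**: `R₄(T(K₄)_n) ≤ (⌊n/e⌋ + 1) · R₄(W_n^{(e)})` (`e ≥ 1`): the full sixth edge is
`⌈n/e⌉` blocks of bond `e`. [folklore] -/
theorem tensorRankD_tetra_le_ceilDiv_sixTetra {n e : ℕ} (he : 0 < e) :
    tensorRankD (tetra F n) ≤ (n / e + 1) * tensorRankD (sixTetra F n e) := by
  rw [← sixTetra_of_le (F := F) (le_refl n)]
  exact tensorRankD_sixTetra_le_ceilDiv he n

/-- The finite sandwich of the sixth-edge family (`1 ≤ e`):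
`R₄(D_n) ≤ R₄(W_n^{(e)}) ≤ min(R₄(T(K₄)_n), e · R₄(D_n))`. -/
theorem tensorRankD_sixTetra_sandwich {n e : ℕ} (he : 1 ≤ e) :
    tensorRankD (pencil F n n) ≤ tensorRankD (sixTetra F n e) ∧
      tensorRankD (sixTetra F n e) ≤ tensorRankD (tetra F n) ∧
      tensorRankD (sixTetra F n e) ≤ e * tensorRankD (pencil F n n) :=
  ⟨tensorRankD_pencil_le_sixTetra he, tensorRankD_sixTetra_le_tetra n e,
    tensorRankD_sixTetra_le_mul_diamond n e⟩

end Corollaries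

end Summit.MatrixMultiplication.MatrixMultiplication.Theorems.EdgePencil

end
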